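import Mathlib
import HarnessLib
import Summits.Ventures.LatticeQCDFlow.Exactness.CircleUniformAngle
import Summits.Ventures.LatticeQCDFlow.Exactness.SU2HeatBathLaw

/-!
# The latitude of a standard Gaussian vector in `ℝ³` is uniform on `(−1, 1)`

HONEST FRAMING: exact (Metropolis-corrected) sampling algorithms for lattice gauge theory;
figures of merit are autocorrelation/cost numbers at stated couplings and volumes; no
continuum-physics claim.

Venture `LatticeQCDFlow` (cell pub-lqcd), topic `Exactness`, FANOUT row 9 (eng-latcore, the
engine `latflow.core`).  NEW WORK of the cell over Mathlib (`polarCoord`, `map_pi_eq_stdGaussian`,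
`measurePreserving_piFinSuccAbove`) and row 9's `CircleUniformAngle.lean` (Rayleigh radius),
`SU2HeatBathLaw.lean` (`E3`).  Nothing is cited as a fact.  Printed counterparts, NAMED ONLY:
Archimedes (hat-box theorem); Marsaglia 1972.

First half of the typing of the engine's AXIS chart (`SU2AxisChart.lean`): the latitude
`cth = 2u − 1` is uniform because the latitude of an isotropic Gaussian vector is.

* `splitE3`, **`stdGaussian_map_splitE3`** — `N(0,I₃) = N(0,1) ⊗ N(0,I₂)` along `x ↦ (x₂, (x₀,x₁))`;
  `norm_sq_E3`;
* `rayleighLaw`, `latitude (z, r) = z/√(r²+z²)`; **`lintegral_latitude`** — for `z ∼ N(0,1)` and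
  an independent Rayleigh radius `r`, the latitude is UNIFORM on `(−1, 1)`: planar polar
  coordinates in the `(z, r)` half-plane, the substitution `c = cos β`
  (`lintegral_sin_mul_comp_cos`), and the radial constant fixed by total mass (no Gaussian
  integral is evaluated);
* `latLaw = unitLaw.map (2·−1)`, `lintegral_latLaw`, **`map_latitude`** — the latitude law IS the
  law of the engine's `cth = 2u − 1`.
-/

namespace Summit.Ventures.LatticeQCDFlow.Exactness

open MeasureTheory Measure Metric Set Real ProbabilityTheory WithLp
open scoped ENNReal

/-! ## §1 Splitting `E3` off its last coordinate -/

/-- The first two coordinates of `x ∈ E3`, as a point of `E2`. -/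
noncomputable def initE3 (x : E3) : E2 := toLp 2 (fun j : Fin 2 => x (Fin.castSucc j))

/-- Coordinates of `initE3`. -/
@[simp] theorem initE3_apply (x : E3) (j : Fin 2) : initE3 x j = x (Fin.castSucc j) := rfl

/-- `x ↦ (x₂, (x₀, x₁))`. -/
noncomputable def splitE3 (x : E3) : ℝ × E2 := (x (Fin.last 2), initE3 x)

/-- `initE3` is measurable. -/
theorem measurable_initE3 : Measurable initE3 :=
  (measurable_toLp 2 _).comp (measurable_pi_lambda _ fun _ =>
    (measurable_pi_apply _).comp (measurable_ofLp 2 _))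

/-- `splitE3` is measurable. -/
theorem measurable_splitE3 : Measurable splitE3 :=
  ((measurable_pi_apply (Fin.last 2)).comp (measurable_ofLp 2 _)).prodMk measurable_initE3

/-- `splitE3` in the coordinates of `Fin 3 → ℝ`: remove coordinate `2`, then pass to `E2`. -/
theorem splitE3_comp_toLp : splitE3 ∘ (toLp 2 : (Fin 3 → ℝ) → E3) =
    Prod.map id (toLp 2 : (Fin 2 → ℝ) → E2) ∘ MeasurableEquiv.piFinSuccAbove (fun _ : Fin 3 => ℝ) (Fin.last 2) := by
  funext x
  refine Prod.ext rfl ?_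
  ext j
  fin_cases j <;> simp [splitE3, initE3, MeasurableEquiv.piFinSuccAbove, Fin.removeNth, Fin.succAbove]

/-- **Splitting the Gaussian**: `(x₂, (x₀,x₁))` under `N(0, I₃)` has law `N(0,1) ⊗ N(0, I₂)`. -/
theorem stdGaussian_map_splitE3 :
    (stdGaussian E3).map splitE3 = (gaussianReal 0 1).prod (stdGaussian E2) := by
  have htoLp2 : Measurable (toLp 2 : (Fin 2 → ℝ) → E2) := measurable_toLp 2 _
  rw [← map_pi_eq_stdGaussian, Measure.map_map measurable_splitE3 (measurable_toLp 2 _), splitE3_comp_toLp,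
    ← Measure.map_map (measurable_id.prodMap htoLp2) (MeasurableEquiv.measurable _),
    (measurePreserving_piFinSuccAbove (fun _ : Fin 3 => gaussianReal 0 1) (Fin.last 2)).map_eq,
    ← Measure.map_prod_map _ _ measurable_id htoLp2, Measure.map_id, map_pi_eq_stdGaussian]

/-- `‖x‖² = ‖(x₀,x₁)‖² + x₂²`. -/
theorem norm_sq_E3 (x : E3) : ‖x‖ ^ 2 = ‖initE3 x‖ ^ 2 + x (Fin.last 2) ^ 2 := by
  rw [EuclideanSpace.real_norm_sq_eq, EuclideanSpace.real_norm_sq_eq, Fin.sum_univ_castSucc]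
  rfl

/-! ## §2 The latitude of `N(0,1) ⊗ Rayleigh` is uniform on `(−1, 1)` -/

/-- The Rayleigh law: the norm of a planar standard Gaussian vector. -/
noncomputable def rayleighLaw : Measure ℝ := (stdGaussian E2).map fun y => ‖y‖

/-- The Rayleigh law is a probability measure. -/
instance isProbabilityMeasure_rayleighLaw : IsProbabilityMeasure rayleighLaw :=
  isProbabilityMeasure_map measurable_norm.aemeasurable

/-- Integrating against the Rayleigh law: density `r e^{−r²/2}` on `(0, ∞)`. -/
theorem lintegral_rayleighLaw {h : ℝ → ℝ≥0∞} (hh : Measurable h) :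
    ∫⁻ r, h r ∂rayleighLaw = ∫⁻ r in Ioi 0, ENNReal.ofReal (r * Real.exp (-r ^ 2 / 2)) * h r := by
  rw [rayleighLaw, lintegral_map hh measurable_norm, lintegral_norm_stdGaussian_two hh]

/-- **The latitude** `c(z, r) = z / √(r² + z²)` of the point `(r, z)` of the half-plane. -/
noncomputable def latitude (p : ℝ × ℝ) : ℝ := p.1 / Real.sqrt (p.2 ^ 2 + p.1 ^ 2)

/-- `latitude` is measurable. -/
theorem measurable_latitude : Measurable latitude := by
  unfold latitude; fun_prop

/-- In polar coordinates `z = ρ cos β`, `r = ρ sin β` (`ρ > 0`) the latitude is `cos β`. -/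
theorem latitude_polar {ρ : ℝ} (hρ : 0 < ρ) (β : ℝ) :
    latitude (ρ * Real.cos β, ρ * Real.sin β) = Real.cos β := by
  rw [latitude, show (ρ * Real.sin β) ^ 2 + (ρ * Real.cos β) ^ 2 = ρ ^ 2 * (Real.sin β ^ 2 + Real.cos β ^ 2)
    by ring, sin_sq_add_cos_sq, mul_one, Real.sqrt_sq hρ.le, mul_div_cancel_left₀ _ hρ.ne']

/-- `cos` maps `(0, π)` onto `(−1, 1)`. -/
theorem image_cos_Ioo : Real.cos '' Ioo 0 π = Ioo (-1) 1 := by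
  ext c
  constructor
  · rintro ⟨β, hβ, rfl⟩
    refine ⟨?_, ?_⟩
    · have := Real.strictAntiOn_cos ⟨hβ.1.le, hβ.2.le⟩ (right_mem_Icc.mpr pi_pos.le) hβ.2
      rwa [Real.cos_pi] at this
    · have := Real.strictAntiOn_cos (left_mem_Icc.mpr pi_pos.le) ⟨hβ.1.le, hβ.2.le⟩ hβ.1
      rwa [Real.cos_zero] at this
  · rintro ⟨h1, h2⟩
    exact ⟨Real.arccos c, ⟨Real.arccos_pos.mpr h2, Real.arccos_lt_pi.mpr h1⟩, Real.cos_arccos h1.le h2.le⟩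

/-- The substitution `c = cos β`: `∫_{(0,π)} sin β · h(cos β) dβ = ∫_{(−1,1)} h(c) dc` for every `h ≥ 0`. -/
theorem lintegral_sin_mul_comp_cos (h : ℝ → ℝ≥0∞) :
    ∫⁻ β in Ioo 0 π, ENNReal.ofReal (Real.sin β) * h (Real.cos β) = ∫⁻ c in Ioo (-1) 1, h c := by
  rw [← image_cos_Ioo, lintegral_image_eq_lintegral_deriv_mul_of_antitoneOn measurableSet_Ioo
    (fun β _ => (Real.hasDerivAt_cos β).hasDerivWithinAt)
    (Real.strictAntiOn_cos.antitoneOn.mono Ioo_subset_Icc_self)]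
  simp only [neg_neg]

/-- `sin β > 0` on `(−π, π)` exactly when `β ∈ (0, π)`. -/
theorem sin_pos_iff_of_mem_Ioo {β : ℝ} (hβ : β ∈ Ioo (-π) π) : 0 < Real.sin β ↔ β ∈ Ioo 0 π := by
  constructor
  · intro h
    refine ⟨?_, hβ.2⟩
    by_contra hle
    exact absurd h (not_lt.mpr (Real.sin_nonpos_of_nonpos_of_neg_pi_le (not_lt.mp hle) hβ.1.le))
  · exact fun h => Real.sin_pos_of_pos_of_lt_pi h.1 h.2

/-- The planar density `φ(ρ cos β) · ρ sin β e^{−(ρ sin β)²/2}`, times the polar Jacobian `ρ`, is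
`(2π)^{−1/2} ρ² e^{−ρ²/2} sin β`. -/
theorem gaussian_rayleigh_polar {ρ : ℝ} (β : ℝ) (hρ : 0 < ρ) :
    ENNReal.ofReal ρ * (gaussianPDF 0 1 (ρ * Real.cos β) *
      ENNReal.ofReal (ρ * Real.sin β * Real.exp (-(ρ * Real.sin β) ^ 2 / 2))) =
      ENNReal.ofReal ((Real.sqrt (2 * π))⁻¹ * ρ ^ 2 * Real.exp (-ρ ^ 2 / 2)) * ENNReal.ofReal (Real.sin β) := by
  simp only [gaussianPDF, gaussianPDFReal, NNReal.coe_one, mul_one, sub_zero]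
  rw [← ENNReal.ofReal_mul (by positivity), ← ENNReal.ofReal_mul hρ.le, ← ENNReal.ofReal_mul (by positivity)]
  congr 1
  rw [show (Real.sqrt (2 * π))⁻¹ * ρ ^ 2 * Real.exp (-ρ ^ 2 / 2) * Real.sin β =
      (Real.sqrt (2 * π))⁻¹ * ρ * (ρ * Real.sin β) * Real.exp (-ρ ^ 2 / 2) by ring,
    show ρ * ((Real.sqrt (2 * π))⁻¹ * Real.exp (-(ρ * Real.cos β) ^ 2 / 2) *
      (ρ * Real.sin β * Real.exp (-(ρ * Real.sin β) ^ 2 / 2))) =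
      (Real.sqrt (2 * π))⁻¹ * ρ * (ρ * Real.sin β) *
        (Real.exp (-(ρ * Real.cos β) ^ 2 / 2) * Real.exp (-(ρ * Real.sin β) ^ 2 / 2)) by ring,
    ← Real.exp_add]
  congr 2
  rw [show -(ρ * Real.cos β) ^ 2 / 2 + -(ρ * Real.sin β) ^ 2 / 2 =
      -ρ ^ 2 / 2 * (Real.cos β ^ 2 + Real.sin β ^ 2) by ring, cos_sq_add_sin_sq, mul_one]

/-- The joint density of `(z, r) ∼ N(0,1) ⊗ Rayleigh` against `h(latitude)`, on the `(z, r)` plane. -/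
noncomputable def latDensity (h : ℝ → ℝ≥0∞) (p : ℝ × ℝ) : ℝ≥0∞ :=
  gaussianPDF 0 1 p.1 *
    ((Ioi (0 : ℝ)).indicator (fun r => ENNReal.ofReal (r * Real.exp (-r ^ 2 / 2))) p.2 * h (latitude p))

/-- `latDensity h` is measurable. -/
theorem measurable_latDensity {h : ℝ → ℝ≥0∞} (hh : Measurable h) : Measurable (latDensity h) := by
  unfold latDensity
  exact ((measurable_gaussianPDF 0 1).comp measurable_fst).mul
    ((((by fun_prop : Measurable fun r : ℝ => ENNReal.ofReal (r * Real.exp (-r ^ 2 / 2))).indicator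
      measurableSet_Ioi).comp measurable_snd).mul (hh.comp measurable_latitude))

/-- Step 1: the law `N(0,1) ⊗ Rayleigh` against `h(latitude)` as a planar Lebesgue integral. -/
theorem lintegral_latitude_eq_volume {h : ℝ → ℝ≥0∞} (hh : Measurable h) :
    ∫⁻ p, h (latitude p) ∂((gaussianReal 0 1).prod rayleighLaw) = ∫⁻ p, latDensity h p := by
  have hpdf : Measurable (gaussianPDF 0 1) := measurable_gaussianPDF 0 1
  have hlat : Measurable fun p : ℝ × ℝ => h (latitude p) := hh.comp measurable_latitude
  have hΨ := measurable_latDensity hh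
  -- right-hand side as an iterated integral
  have hR : ∫⁻ p, latDensity h p = ∫⁻ z, ∫⁻ r, latDensity h (z, r) := by
    rw [Measure.volume_eq_prod, lintegral_prod _ hΨ.aemeasurable]
  rw [hR, lintegral_prod _ hlat.aemeasurable, gaussianReal_of_var_ne_zero 0 one_ne_zero]
  -- the inner `r`-integral
  have hinner : ∀ z : ℝ, ∫⁻ r, h (latitude (z, r)) ∂rayleighLaw =
      ∫⁻ r, (Ioi (0 : ℝ)).indicator (fun r => ENNReal.ofReal (r * Real.exp (-r ^ 2 / 2))) r * h (latitude (z, r)) := by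
    intro z
    rw [lintegral_rayleighLaw (h := fun r => h (latitude (z, r)))
      (hh.comp (measurable_latitude.comp (measurable_const.prodMk measurable_id))),
      ← lintegral_indicator measurableSet_Ioi]
    refine lintegral_congr fun r => ?_
    by_cases hr : r ∈ Ioi (0 : ℝ)
    · rw [indicator_of_mem hr, indicator_of_mem hr]
    · rw [indicator_of_notMem hr, indicator_of_notMem hr, zero_mul]
  simp_rw [hinner]
  have hG : Measurable fun z : ℝ => ∫⁻ r, (Ioi (0 : ℝ)).indicator
      (fun r => ENNReal.ofReal (r * Real.exp (-r ^ 2 / 2))) r * h (latitude (z, r)) :=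
    ((((by fun_prop : Measurable fun r : ℝ => ENNReal.ofReal (r * Real.exp (-r ^ 2 / 2))).indicator
      measurableSet_Ioi).comp measurable_snd).mul
      (hh.comp (measurable_latitude.comp (measurable_fst.prodMk measurable_snd)))).lintegral_prod_right'
  rw [lintegral_withDensity_eq_lintegral_mul _ hpdf hG]
  refine lintegral_congr fun z => ?_
  rw [Pi.mul_apply, ← lintegral_const_mul' _ _ (by simp [gaussianPDF])]
  rfl

/-- Step 2 (polar coordinates): for every measurable `h ≥ 0`,
`∫ h(latitude) d(N(0,1) ⊗ Rayleigh) = M · ∫_{(−1,1)} h(c) dc` with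
`M = ∫_{ρ>0} (2π)^{−1/2} ρ² e^{−ρ²/2} dρ` left symbolic. -/
theorem lintegral_latitude_polar {h : ℝ → ℝ≥0∞} (hh : Measurable h) :
    ∫⁻ p, h (latitude p) ∂((gaussianReal 0 1).prod rayleighLaw) =
      (∫⁻ ρ in Ioi 0, ENNReal.ofReal ((Real.sqrt (2 * π))⁻¹ * ρ ^ 2 * Real.exp (-ρ ^ 2 / 2))) *
        ∫⁻ c in Ioo (-1) 1, h c := by
  have hΨ := measurable_latDensity hh
  rw [lintegral_latitude_eq_volume hh, ← lintegral_comp_polarCoord_symm,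
    show polarCoord.target = Ioi (0 : ℝ) ×ˢ Ioo (-π) π from rfl, Measure.volume_eq_prod,
    setLIntegral_prod (fun p : ℝ × ℝ => ENNReal.ofReal p.1 • latDensity h (polarCoord.symm p))
      ((ENNReal.measurable_ofReal.comp measurable_fst).smul
      (hΨ.comp (by fun_prop : Measurable fun p : ℝ × ℝ => (p.1 * Real.cos p.2, p.1 * Real.sin p.2)))).aemeasurable,
    ← lintegral_mul_const _ (by fun_prop : Measurable fun ρ : ℝ =>
      ENNReal.ofReal ((Real.sqrt (2 * π))⁻¹ * ρ ^ 2 * Real.exp (-ρ ^ 2 / 2)))]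
  refine setLIntegral_congr_fun measurableSet_Ioi fun ρ hρ => ?_
  have hρ' : (0 : ℝ) < ρ := hρ
  -- pointwise in `β`
  have hpt : ∀ β ∈ Ioo (-π) π, ENNReal.ofReal ρ • latDensity h (ρ * Real.cos β, ρ * Real.sin β) =
      (Ioo 0 π).indicator (fun β => ENNReal.ofReal ((Real.sqrt (2 * π))⁻¹ * ρ ^ 2 * Real.exp (-ρ ^ 2 / 2)) *
        (ENNReal.ofReal (Real.sin β) * h (Real.cos β))) β := by
    intro β hβ
    rw [smul_eq_mul, latDensity, latitude_polar hρ']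
    by_cases hs : 0 < Real.sin β
    · rw [indicator_of_mem (show ρ * Real.sin β ∈ Ioi (0 : ℝ) from mul_pos hρ' hs),
        indicator_of_mem ((sin_pos_iff_of_mem_Ioo hβ).mp hs), ← mul_assoc (gaussianPDF 0 1 _), ← mul_assoc,
        gaussian_rayleigh_polar β hρ', mul_assoc]
    · rw [indicator_of_notMem (show ρ * Real.sin β ∉ Ioi (0 : ℝ) from fun h' =>
          hs (pos_of_mul_pos_right h' hρ'.le)),
        indicator_of_notMem (fun h' => hs ((sin_pos_iff_of_mem_Ioo hβ).mpr h')), zero_mul, mul_zero, mul_zero]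
  simp only [polarCoord_symm_apply]
  rw [setLIntegral_congr_fun measurableSet_Ioo hpt, lintegral_indicator measurableSet_Ioo,
    Measure.restrict_restrict measurableSet_Ioo,
    inter_eq_left.mpr (Ioo_subset_Ioo (by linarith [pi_pos]) le_rfl),
    lintegral_const_mul' _ _ ENNReal.ofReal_ne_top, lintegral_sin_mul_comp_cos]

/-- **The latitude is uniform on `(−1, 1)`.**  For every measurable `h ≥ 0`,
`∫ h(latitude) d(N(0,1) ⊗ Rayleigh) = ½ ∫_{(−1,1)} h(c) dc` — the radial constant is fixed by
total mass. -/
theorem lintegral_latitude {h : ℝ → ℝ≥0∞} (hh : Measurable h) :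
    ∫⁻ p, h (latitude p) ∂((gaussianReal 0 1).prod rayleighLaw) = 2⁻¹ * ∫⁻ c in Ioo (-1) 1, h c := by
  have hM := lintegral_latitude_polar (h := fun _ => 1) measurable_const
  rw [lintegral_const, measure_univ, mul_one, setLIntegral_const, Real.volume_Ioo,
    show (1 : ℝ) - -1 = 2 by norm_num, ENNReal.ofReal_ofNat] at hM
  have hM' : (∫⁻ ρ in Ioi 0, ENNReal.ofReal ((Real.sqrt (2 * π))⁻¹ * ρ ^ 2 * Real.exp (-ρ ^ 2 / 2))) = 2⁻¹ := by
    rw [one_mul] at hM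
    exact ENNReal.eq_inv_of_mul_eq_one_left hM.symm
  rw [lintegral_latitude_polar hh, hM']

/-- The law of the engine's `cth = 2u − 1`. -/
noncomputable def latLaw : Measure ℝ := unitLaw.map fun u => 2 * u - 1

/-- Integrating against `latLaw`: `½ ∫_{(−1,1)}`. -/
theorem lintegral_latLaw {h : ℝ → ℝ≥0∞} (hh : Measurable h) :
    ∫⁻ c, h c ∂latLaw = 2⁻¹ * ∫⁻ c in Ioo (-1) 1, h c := by
  rw [latLaw, lintegral_map hh (by fun_prop), lintegral_unitLaw]
  have himg : (fun c : ℝ => (c + 1) / 2) '' Ioo (-1) 1 = Ioo 0 1 := by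
    ext u
    constructor
    · rintro ⟨c, hc, rfl⟩; exact ⟨by linarith [hc.1], by linarith [hc.2]⟩
    · intro hu; exact ⟨2 * u - 1, ⟨by linarith [hu.1], by linarith [hu.2]⟩, by ring⟩
  have hderiv : ∀ c ∈ Ioo (-1 : ℝ) 1, HasDerivWithinAt (fun c : ℝ => (c + 1) / 2) (1 / 2) (Ioo (-1) 1) c :=
    fun c _ => (((hasDerivAt_id' c).add_const 1).div_const 2).hasDerivWithinAt
  have hinj : InjOn (fun c : ℝ => (c + 1) / 2) (Ioo (-1) 1) := fun a _ b _ hab => by simpa using hab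
  rw [← himg, lintegral_image_eq_lintegral_abs_deriv_mul measurableSet_Ioo hderiv hinj,
    ← lintegral_const_mul' _ _ (by simp)]
  refine setLIntegral_congr_fun measurableSet_Ioo fun c _ => ?_
  rw [abs_of_pos (by norm_num : (0 : ℝ) < 1 / 2), show 2 * ((c + 1) / 2) - 1 = c by ring, one_div,
    ENNReal.ofReal_inv_of_pos two_pos, ENNReal.ofReal_ofNat]

/-- **The latitude law is the law of `2u − 1`.** -/
theorem map_latitude : ((gaussianReal 0 1).prod rayleighLaw).map latitude = latLaw := by
  refine Measure.ext_of_lintegral _ fun h hh => ?_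
  rw [lintegral_map hh measurable_latitude, lintegral_latitude hh, lintegral_latLaw hh]

/-- `latLaw` is a probability measure. -/
instance isProbabilityMeasure_latLaw : IsProbabilityMeasure latLaw :=
  isProbabilityMeasure_map (by fun_prop : Measurable fun u : ℝ => 2 * u - 1).aemeasurable

end Summit.Ventures.LatticeQCDFlow.Exactness
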